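import Mathlib
import Summits.ValiantsHypothesis.ValiantsHypothesis.Theorems.PerDivisionHard.Negative.PerSupportBound
import Literature.Computability.AlgebraicComplexity.ArithCircuitProofs
import Literature.Computability.AlgebraicComplexity.PermanentIrreducible

/-!
# `DivisionGap.PerMultiplesHard` (stmt-ValiantsHypothesis-5068), line `uncharged-face-walk`:
Jerrum–Snir by SUB-support (stub `stub_richFaces`)

For `n ≥ 6` and every set of cells `G ⊆ [n]²`, the face permanent
`per_G := Σ_{σ ⊆ G} x^{μ_σ}` (sum over the permutations all of whose cells `(σ i, i)` lie in `G`)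
satisfies

  `2^{n/3} · #PM(G) ≤ L⁺(per_G) · n!`,   `#PM(G)` = the number of such permutations,

for the tree's monotone fan-in-two `complexity` `L⁺` over `ℝ≥0`: every face of the Birkhoff
polytope is as hard as its perfect-matching count.

Mechanism (the tree's `two_pow_le_prodCount_of_support_eq_perPoly`, file
`Theorems/PerDivisionHard/Negative/PerSupportBound.lean`, with the hypothesis
`supp p = supp per_n` weakened to `supp p ⊆ supp per_n` and the count `n! = |supp per_n|` replaced by
`|supp p|`):
1. `supp p ⊆ supp per_n` makes `p` homogeneous of degree `n`, so a fan-in-two circuit `P` for `p`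
   writes `p = Σ_{t<s} a_t b_t` with `s ≤ prodCount P` and `deg a_t ∈ (n/3, 2(n/3)]`
   (`exists_decomposition`).
2. No cancellation over `ℝ≥0`: `supp (a_t b_t) ⊆ supp p ⊆ supp per_n`, so the rectangle bound
   `card_support_mul_choose_le` and `two_pow_le_choose_middle` give `2^{n/3} · |supp (a_t b_t)| ≤ n!`.
3. Summing, `2^{n/3} · |supp p| ≤ Σ_t 2^{n/3} · |supp (a_t b_t)| ≤ s · n! ≤ prodCount P · n!`.
4. For `p = per_G`: `supp per_G = μ(PM(G))` has `#PM(G)` elements (`permMonomial_injective`) and lies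
   in `supp per_n`; take a minimal circuit (`exists_computes_size_eq_complexity`,
   `prodCount_le_size`).

Log (stub-worker): `two_pow_mul_card_support_le` is adapted from the tree's
`two_pow_le_prodCount_of_support_eq_perPoly` (`=` weakened to `⊆`, no emptiness split needed since
both sides scale with `|supp p|`); the support of a sum of distinct permutation monomials is computed
directly (`support_sum_monomial_permMonomial`); the stub is the case `S = PM(G)` of
`two_pow_mul_card_le_complexity_mul`. [cite: JerrumSnir1982, §4.3 and Cor. 3.5]
-/

noncomputable section

open MvPolynomial Literature.Computability.AlgebraicComplexity
open scoped NNReal BigOperators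
open Summit.ValiantsHypothesis.ValiantsHypothesis.Theorems.PerDivisionHard.Negative
open Literature.Barriers.ValiantsHypothesis

namespace Summit.ValiantsHypothesis.ValiantsHypothesis.Theorems.DivisionGap.PerMultiplesHard.RichFaces

variable {m : ℕ}

/-! ### Jerrum–Snir by sub-support of the permanent (weighted fan-in-two circuits over `ℝ≥0`) -/

-- adapted from Theorems/PerDivisionHard/Negative/PerSupportBound.lean
-- (`two_pow_le_prodCount_of_support_eq_perPoly`, support equality weakened to inclusion)
/-- **Jerrum–Snir by SUB-support for the permanent.**  If every monomial of `p` is a permutation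
monomial (`supp p ⊆ supp per_m`, `m ≥ 6`) then every fan-in-two circuit over `ℝ≥0` computing `p`
has at least `2^{m/3} · |supp p| / m!` product gates: the balanced decomposition
`p = Σ_t a_t b_t` (`exists_decomposition`) has each `supp (a_t b_t) ⊆ supp per_m` (no
cancellation), hence `2^{m/3} · |supp (a_t b_t)| ≤ m!` by the rectangle bound; sum over `t`.
[cite: JerrumSnir1982, §4.3 and Cor. 3.5] -/
theorem two_pow_mul_card_support_le (hm : 6 ≤ m)
    {p : MvPolynomial (Fin m × Fin m) ℝ≥0} (hp : p.support ⊆ (perPoly (Fin m) ℝ≥0).support)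
    {P : ArithCircuit ℝ≥0 (Fin m × Fin m)} (hP2 : P.IsFanInTwo) (hP : P.Computes p) :
    2 ^ (m / 3) * p.support.card ≤ prodCount P * m.factorial := by
  classical
  have heval : P.eval = p := hP
  have hhom : p.IsHomogeneous m := by
    intro d hd
    have hd' : d ∈ (perPoly (Fin m) ℝ≥0).support := hp (mem_support_iff.mpr hd)
    have := perPoly_isHomogeneous (n := Fin m) (k := ℝ≥0) (mem_support_iff.mp hd')
    rwa [Fintype.card_fin] at this
  have hm1 : 1 ≤ m / 3 := by omega
  have hmN : m / 3 < m := by omega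
  obtain ⟨L, hLlen, hLsum, hLdeg⟩ :=
    Literature.Barriers.ValiantsHypothesis.exists_decomposition hm1 hmN _ P le_rfl hP2
      (by rw [heval]; exact hhom)
  rw [heval] at hLsum
  -- each product covers at most `m!/2^{m/3}` monomials: `2^{m/3} |mon(ab)| ≤ m!`
  have hterm : ∀ ab ∈ L, 2 ^ (m / 3) * (ab.1 * ab.2).support.card ≤ m.factorial := by
    intro ab hab
    by_cases hb : ab.2 = 0
    · simp [hb]
    have hdeg := hLdeg ab hab
    have ha : ab.1 ≠ 0 := by
      intro ha
      rw [ha, totalDegree_zero] at hdeg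
      omega
    have hsub : (ab.1 * ab.2).support ⊆ (perPoly (Fin m) ℝ≥0).support := by
      obtain ⟨q, hq⟩ := exists_sum_eq_add_of_mem (fun ab : MvPolynomial _ ℝ≥0 × _ => ab.1 * ab.2)
        L ab hab
      exact (support_subset_of_eq_add (hLsum.trans hq)).trans hp
    obtain ⟨hcard, -⟩ := card_support_mul_choose_le hsub ha hb
    have hch := two_pow_le_choose_middle hdeg.1 hdeg.2
    calc 2 ^ (m / 3) * (ab.1 * ab.2).support.card
        ≤ m.choose ab.1.totalDegree * (ab.1 * ab.2).support.card := Nat.mul_le_mul_right _ hch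
      _ = (ab.1 * ab.2).support.card * m.choose ab.1.totalDegree := mul_comm _ _
      _ ≤ m.factorial := hcard
  -- count: `2^{m/3} |supp p| ≤ Σ 2^{m/3} |mon(a_i b_i)| ≤ |L| m!`
  have hsupp : p.support.card ≤ (L.map fun ab => (ab.1 * ab.2).support.card).sum := by
    rw [hLsum]
    clear hLsum hLlen hLdeg hterm
    induction L with
    | nil => simp
    | cons ab L ih =>
      simp only [List.map_cons, List.sum_cons]
      exact (Finset.card_le_card support_add).trans ((Finset.card_union_le _ _).trans
        (Nat.add_le_add_left ih _))
  calc 2 ^ (m / 3) * p.support.card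
      ≤ 2 ^ (m / 3) * (L.map fun ab => (ab.1 * ab.2).support.card).sum :=
        Nat.mul_le_mul_left _ hsupp
    _ = (L.map fun ab => 2 ^ (m / 3) * (ab.1 * ab.2).support.card).sum := by
        rw [List.sum_map_mul_left]
    _ ≤ (L.map fun _ => m.factorial).sum := List.sum_le_sum (fun ab hab => hterm ab hab)
    _ = L.length * m.factorial := by rw [List.map_const', List.sum_replicate, smul_eq_mul]
    _ ≤ prodCount P * m.factorial := Nat.mul_le_mul_right _ hLlen

/-! ### Sums of distinct permutation monomials -/

/-- The support of a sum of distinct permutation monomials `Σ_{σ ∈ S} x^{μ_σ}` is `μ(S)`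
(`μ` is injective, coefficients are `1`). [folklore] -/
theorem support_sum_monomial_permMonomial (S : Finset (Equiv.Perm (Fin m))) :
    (∑ σ ∈ S, monomial (permMonomial σ) (1 : ℝ≥0) : MvPolynomial (Fin m × Fin m) ℝ≥0).support =
      S.image permMonomial := by
  classical
  ext d
  rw [mem_support_iff, coeff_sum, Finset.mem_image]
  simp only [coeff_monomial]
  constructor
  · intro h
    obtain ⟨σ, hσ, hne⟩ := Finset.exists_ne_zero_of_sum_ne_zero h
    refine ⟨σ, hσ, ?_⟩
    by_contra hd
    exact hne (if_neg hd)
  · rintro ⟨σ, hσ, rfl⟩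
    rw [Finset.sum_eq_single σ]
    · simp
    · intro τ _ hτ
      exact if_neg (permMonomial_injective.ne hτ)
    · intro h
      exact absurd hσ h

/-- **Every set of permutations is as hard as its size**: for `m ≥ 6` and every finite set `S`
of permutations, `2^{m/3} · |S| ≤ L⁺(Σ_{σ ∈ S} x^{μ_σ}) · m!` — the support of the sum is
`μ(S)` (size `|S|`, inside `supp per_m`); apply `two_pow_mul_card_support_le` to a minimal
circuit (`exists_computes_size_eq_complexity`, `prodCount_le_size`).
[cite: JerrumSnir1982, §4.3 and Cor. 3.5] -/
theorem two_pow_mul_card_le_complexity_mul (hm : 6 ≤ m) (S : Finset (Equiv.Perm (Fin m))) :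
    2 ^ (m / 3) * S.card ≤
      complexity (∑ σ ∈ S, monomial (permMonomial σ) (1 : ℝ≥0) :
        MvPolynomial (Fin m × Fin m) ℝ≥0) * m.factorial := by
  classical
  have hsuppS := support_sum_monomial_permMonomial S
  have hcard : (∑ σ ∈ S, monomial (permMonomial σ) (1 : ℝ≥0) :
      MvPolynomial (Fin m × Fin m) ℝ≥0).support.card = S.card := by
    rw [hsuppS, Finset.card_image_of_injective _ permMonomial_injective]
  have hsub : (∑ σ ∈ S, monomial (permMonomial σ) (1 : ℝ≥0) :
      MvPolynomial (Fin m × Fin m) ℝ≥0).support ⊆ (perPoly (Fin m) ℝ≥0).support := by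
    rw [hsuppS]
    intro d hd
    obtain ⟨σ, -, rfl⟩ := Finset.mem_image.1 hd
    exact (JerrumSnir.mem_support_perPoly ℝ≥0).2 ⟨σ, rfl⟩
  obtain ⟨P, h2, hP, hsize⟩ := ArithCircuit.exists_computes_size_eq_complexity
    (∑ σ ∈ S, monomial (permMonomial σ) (1 : ℝ≥0) : MvPolynomial (Fin m × Fin m) ℝ≥0)
  rw [← hcard, ← hsize]
  exact (two_pow_mul_card_support_le hm hsub h2 hP).trans
    (Nat.mul_le_mul_right _ (prodCount_le_size P))

/-! ### The stub -/

/-- **stub_richFaces — Jerrum–Snir by SUB-support: every face is as hard as its matching count.**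
For `n ≥ 6` and every `G ⊆ [n]²`: `2^{n/3} · #PM(G) ≤ L⁺(per_G) · n!`, where
`per_G = Σ_{σ ⊆ G} x^{μ_σ}` and `#PM(G)` is the number of permutations inside `G`
(the case `S = PM(G)` of `two_pow_mul_card_le_complexity_mul`).
[cite: JerrumSnir1982, §4.3 and Cor. 3.5] -/
theorem stub_richFaces :
    ∀ n ≥ 6, ∀ G : Finset (Fin n × Fin n),
      2 ^ (n / 3) * ((Finset.univ : Finset (Equiv.Perm (Fin n))).filter (fun σ => ∀ i, (σ i, i) ∈ G)).card ≤
        complexity (∑ σ ∈ (Finset.univ : Finset (Equiv.Perm (Fin n))).filter (fun σ => ∀ i, (σ i, i) ∈ G),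
            monomial (permMonomial σ) (1 : ℝ≥0)) * n.factorial := by
  intro n hn G
  exact two_pow_mul_card_le_complexity_mul hn _

end Summit.ValiantsHypothesis.ValiantsHypothesis.Theorems.DivisionGap.PerMultiplesHard.RichFaces

end
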